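import Mathlib
import Summits.ResolutionOfSingularities.ResolutionOfSingularities.Theorems.HomologicalConductorPersistenceSurfaceSaturationResidualFour
import Summits.ResolutionOfSingularities.ResolutionOfSingularities.Theorems.HomologicalConductorNoZenoPersistenceStep
import HarnessLib

/-!
# Rung S-2 `PersistenceSurface` (stmt-ResolutionOfSingularities-19970) — the step INTO a stage whose cohomology
# annihilator is the whole maximal ideal is free (level-free form)

Route `ResolutionOfSingularities/HomologicalConductor`, chain W4.4b, rung S-2 `PersistenceSurface`
(stmt-ResolutionOfSingularities-19970), skeleton `1a77c002` (stubs `stub_localChartPersistenceSurface`,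
`stub_saturationFourSurfaceResidualFour`, `stub_completedStepPersistenceRationalNormal'`,
`stub_levelFourPersistenceNonnormalOrNonrational'`).  Seat leafhand-res-homologicalconduct-10 (gen 0).
`[OURS · L1 w44b]`; folklore bookkeeping over landed tree lemmas; NOT a statement of the manuscript under review
(Hironaka 2017) and no statement of that manuscript is used; AI-written, weaker than expert review.

## Content

The doors of record exempt the steps `T_m → T_(m+1)` whose upper stage is REGULAR
(`PersistenceSurfaceSaturationResidualFour.ca_subset_ca_succ_of_isRegularLocalRing_succ`: `ca(T_(m+1)) = T_(m+1)`),
and res-D-pv-043's `…PersistenceSurfaceMaximalConductorStep` records, at LEVEL FOUR and through the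
`HasStepDualCover` interface, that a step into an upper point with `𝔪_(T_(m+1)) ⊆ ca⁴(T_(m+1))` is free as well.
This file is the LEVEL-FREE form of the latter for the rung itself, stated with the valuation of `O` (every stage is
`O`-local, so `𝔪_(T_(m+1)) = {y ∈ T_(m+1) | v_O(y) < 1}`):

* `valuation_eq_one_or_lt_one_of_mem_tower` — an element of a stage has `O`-value `1` or `< 1`;
* `one_mem_ca_of_mem_ca_of_valuation_eq_one` — a cohomology annihilator of `O`-value `1` forces `1 ∈ ca(T_m)`
  (stages invert their `O`-units, `SyzygyFlattening.inv_mem_locAt`);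
* `isRegularLocalRing_tower_of_one_mem_ca` — `1 ∈ ca(T_m)` makes the stage regular
  ([IyengarTakahashi2014, Example 2.5 / Lemma 2.10]: `ca = ⊤ ⇒` regular, tree
  `isRegularLocalRing_of_cohomologyAnnihilator_eq_top`);
* **`ca_subset_ca_succ_of_forall_valuation_lt_one_mem_ca`** — THE DOOR: if every element of `T_(m+1)` of positive
  `O`-value lies in `ca(T_(m+1))` («the upper stage has MAXIMAL cohomology annihilator», e.g. an `A₁` point or the
  vertex of a cone over a rational normal curve, `…PersistenceCyclicQuotientVeronese`), then
  `ca(T_m) ⊆ ca(T_(m+1))` — with NO hypothesis on `T_m` (a cohomology annihilator of value `1` downstairs makes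
  `T_m` regular and the tower stationary, `tower_succ_eq_self_of_isRegularLocalRing`);
* `not_isUnit_of_valuation_lt_one`, `ca_subset_ca_succ_of_forall_not_isUnit_mem_cohomologyAnnihilator` — the
  same door fed ring-internally: every non-unit of `↥T_(m+1)` in `cohomologyAnnihilator ↥T_(m+1)` suffices;
* `persistenceSurface_of_forall_step_regular_or_maximal_or` — the rung's step trichotomy as a door: at every step
  either `T_(m+1)` is regular, or `T_(m+1)` has maximal cohomology annihilator, or the step is supplied by the
  residual hypothesis; the content of `PersistenceSurface` sits exactly at the steps into SINGULAR upper points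
  whose cohomology annihilator is NOT the maximal ideal.

References (mechanism only): S. B. Iyengar, R. Takahashi, *Annihilation of cohomology and strong generation of
module categories*, IMRN 2016, Example 2.5, Lemma 2.10 [`IyengarTakahashi2014`] — used through landed tree lemmas.
-/

noncomputable section

-- single-problem summit: the doubled namespace component `ResolutionOfSingularities` is forced
set_option linter.dupNamespace false

namespace Summit.ResolutionOfSingularities.ResolutionOfSingularities.Theorems.HomologicalConductor.PersistenceSurfaceMaximalAnnihilatorStep

open Summit.ResolutionOfSingularities.ResolutionOfSingularities.Theorems
open Summit.ResolutionOfSingularities.ResolutionOfSingularities.Theorems.NoZeno.Birth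
open Summit.ResolutionOfSingularities.ResolutionOfSingularities.Theorems.HomologicalConductor.PersistenceSurfaceSaturationResidualFour

variable {k K : Type} [Field k] [Field K] [Algebra k K]

/-! ## Values of stage elements -/

/-- Every element of a stage `T_m ⊆ O` has `O`-value `1` (an `O`-unit) or `< 1` (in the centre of `O`).
[folklore] -/
theorem valuation_eq_one_or_lt_one_of_mem_tower (O : ValuationSubring K) (A : Subalgebra k K)
    (hk : ∀ c : k, algebraMap k K c ∈ O) (hAO : A.toSubring ≤ O.toSubring) (m : ℕ) {x : K}
    (hx : x ∈ tower O A m) : O.valuation x = 1 ∨ O.valuation x < 1 := by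
  have hxO : x ∈ O := mem_valuationSubring_of_mem_tower O hk hAO m x hx
  have hle : O.valuation x ≤ 1 := (O.valuation_le_one_iff x).mpr hxO
  rcases hle.lt_or_eq with h | h
  · exact Or.inr h
  · exact Or.inl h

/-! ## A cohomology annihilator of value one makes the stage regular -/

/-- If some `x ∈ ca(T_m)` is an `O`-unit then `1 ∈ ca(T_m)`: the stage `T_m = loc O B` inverts its `O`-units
(`SyzygyFlattening.inv_mem_locAt`) and `ca(T_m)` is an ideal (`mul_mem_ca`). [folklore] -/
theorem one_mem_ca_of_mem_ca_of_valuation_eq_one (O : ValuationSubring K) (A : Subalgebra k K)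
    (hk : ∀ c : k, algebraMap k K c ∈ O) (hAO : A.toSubring ≤ O.toSubring) (m : ℕ) {x : K}
    (hx : x ∈ ca (tower O A m)) (hv : O.valuation x = 1) : (1 : K) ∈ ca (tower O A m) := by
  have hxT : x ∈ tower O A m := ca_subset _ hx
  obtain ⟨B, hBO, hTB⟩ := exists_tower_eq_loc O A hk hAO m
  have hx0 : x ≠ 0 := by
    rintro rfl
    rw [map_zero] at hv
    exact zero_ne_one hv
  have hxinv : x⁻¹ ∈ tower O A m := by
    rw [hTB, loc_eq_locAt] at hxT ⊢
    exact SyzygyFlattening.inv_mem_locAt O B hBO hxT hv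
  have h := mul_mem_ca (tower O A m) hxinv hx
  rwa [inv_mul_cancel₀ hx0] at h

/-- `1 ∈ ca(T_m)` makes the stage `T_m` a regular local ring (`ca(T_m) = ⊤`, [IyengarTakahashi2014, Example 2.5 /
Lemma 2.10], tree `isRegularLocalRing_of_cohomologyAnnihilator_eq_top`; the stage is noetherian by
`stub_towerNoetherian` and local as `loc O B`). [cite: IyengarTakahashi2014, Lemma 2.10] -/
theorem isRegularLocalRing_tower_of_one_mem_ca (O : ValuationSubring K) (A : Subalgebra k K)
    (hk : ∀ c : k, algebraMap k K c ∈ O) (hA : A.FG) (hfr : IsFractionRing ↥A K)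
    (hAO : A.toSubring ≤ O.toSubring) (m : ℕ) (h1 : (1 : K) ∈ ca (tower O A m)) :
    IsRegularLocalRing ↥(tower O A m) := by
  haveI : IsNoetherianRing ↥(tower O A m) := stub_towerNoetherian k K O A hk hA hfr hAO m
  haveI : IsLocalRing ↥(tower O A m) := by
    obtain ⟨B, hBO, hTB⟩ := exists_tower_eq_loc O A hk hAO m
    rw [hTB, loc_eq_locAt]
    exact SyzygyFlattening.isLocalRing_locAt O B hBO
  have h1' : (1 : ↥(tower O A m)) ∈
      Literature.RingTheory.CohomologyAnnihilator.cohomologyAnnihilator ↥(tower O A m) :=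
    (tn_coe_mem_ca_iff (tower O A m) 1).mp (by simpa using h1)
  have htop : Literature.RingTheory.CohomologyAnnihilator.cohomologyAnnihilator ↥(tower O A m) = ⊤ :=
    (Ideal.eq_top_iff_one _).mpr h1'
  exact Literature.RingTheory.CohomologyAnnihilator.isRegularLocalRing_of_cohomologyAnnihilator_eq_top htop

/-! ## The door: a stage with maximal cohomology annihilator absorbs the step -/

/-- **The step into a stage with MAXIMAL cohomology annihilator is free.**  If every element of `T_(m+1)` of
positive `O`-value (i.e. every non-unit of the `O`-local stage `T_(m+1)`) lies in `ca(T_(m+1))`, then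
`ca(T_m) ⊆ ca(T_(m+1))`.  No hypothesis on `T_m`: an `x ∈ ca(T_m)` of value `< 1` is caught by the hypothesis
(`T_m ≤ T_(m+1)`), and one of value `1` makes `T_m` regular (`isRegularLocalRing_tower_of_one_mem_ca`), whence
`T_(m+1) = T_m` (`tower_succ_eq_self_of_isRegularLocalRing`). [OURS · L1 w44b] -/
theorem ca_subset_ca_succ_of_forall_valuation_lt_one_mem_ca (O : ValuationSubring K) (A : Subalgebra k K)
    (hk : ∀ c : k, algebraMap k K c ∈ O) (hA : A.FG) (hfr : IsFractionRing ↥A K)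
    (hAO : A.toSubring ≤ O.toSubring) (m : ℕ)
    (hmax : ∀ y ∈ tower O A (m + 1), O.valuation y < 1 → y ∈ ca (tower O A (m + 1))) :
    ca (tower O A m) ⊆ ca (tower O A (m + 1)) := by
  intro x hx
  have hxT : x ∈ tower O A m := ca_subset _ hx
  have hle : tower O A m ≤ tower O A (m + 1) := fun y hy => by
    rw [tower_succ]
    exact SyzygyFlattening.self_le_locAt O _
      (SyzygyFlattening.self_le_nrm _ (Algebra.subset_adjoin (Or.inl hy)))
  rcases valuation_eq_one_or_lt_one_of_mem_tower O A hk hAO m hxT with hv | hv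
  · have hreg := isRegularLocalRing_tower_of_one_mem_ca O A hk hA hfr hAO m
      (one_mem_ca_of_mem_ca_of_valuation_eq_one O A hk hAO m hx hv)
    rw [tower_succ_eq_self_of_isRegularLocalRing O A hk hfr hAO m hreg]
    exact hx
  · exact hmax x (hle hxT) hv

/-- The same door with the hypothesis placed on the non-units of `T_(m+1)` read inside `K`
(`y ∈ T_(m+1)`, `y⁻¹ ∉ T_(m+1)`): these are exactly the elements of `O`-value `< 1` or, harmlessly, `0`.
[OURS · L1 w44b] -/
theorem ca_subset_ca_succ_of_forall_inv_not_mem_mem_ca (O : ValuationSubring K) (A : Subalgebra k K)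
    (hk : ∀ c : k, algebraMap k K c ∈ O) (hA : A.FG) (hfr : IsFractionRing ↥A K)
    (hAO : A.toSubring ≤ O.toSubring) (m : ℕ)
    (hmax : ∀ y ∈ tower O A (m + 1), y⁻¹ ∉ tower O A (m + 1) → y ∈ ca (tower O A (m + 1))) :
    ca (tower O A m) ⊆ ca (tower O A (m + 1)) := by
  refine ca_subset_ca_succ_of_forall_valuation_lt_one_mem_ca O A hk hA hfr hAO m fun y hy hv => ?_
  by_cases hy0 : y = 0
  · rw [hy0]; exact zero_mem_ca _
  · refine hmax y hy fun hinv => ?_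
    -- `y⁻¹ ∈ T_(m+1) ⊆ O` would give `v(y⁻¹) ≤ 1`, i.e. `v(y) ≥ 1`
    have hinvO : y⁻¹ ∈ O := mem_valuationSubring_of_mem_tower O hk hAO (m + 1) _ hinv
    have hle : O.valuation y⁻¹ ≤ 1 := (O.valuation_le_one_iff _).mpr hinvO
    rw [map_inv₀] at hle
    have hvy0 : O.valuation y ≠ 0 := by
      intro h0
      exact hy0 ((map_eq_zero O.valuation).mp h0)
    have h1le : 1 ≤ O.valuation y := (inv_le_one₀ (zero_lt_iff.mpr hvy0)).mp hle
    exact absurd hv (not_lt.mpr h1le)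

/-! ## The rung's step trichotomy as a door -/

/-- **Step trichotomy [OURS · L1 w44b].**  `PersistenceSurface` follows if at every step of every surface tower
one of: (a) `T_(m+1)` is regular; (b) `T_(m+1)` has maximal cohomology annihilator (every element of positive
`O`-value lies in `ca(T_(m+1))`); (c) the step `ca(T_m) ⊆ ca(T_(m+1))` is supplied.  The residual content of the
rung is (c) at the steps into SINGULAR upper points with NON-maximal cohomology annihilator. -/
theorem persistenceSurface_of_forall_step_regular_or_maximal_or
    (h : ∀ p : ℕ, p.Prime → ∀ (k K : Type) [Field k] [CharP k p] [Field K] [Algebra k K]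
      (O : ValuationSubring K) (A : Subalgebra k K), (∀ c : k, algebraMap k K c ∈ O) → A.FG →
      IsFractionRing ↥A K → A.toSubring ≤ O.toSubring → ringKrullDim ↥A ≤ 2 → ∀ m : ℕ,
      IsRegularLocalRing ↥(tower O A (m + 1)) ∨
        (∀ y ∈ tower O A (m + 1), O.valuation y < 1 → y ∈ ca (tower O A (m + 1))) ∨
        ca (tower O A m) ⊆ ca (tower O A (m + 1))) :
    Summit.ResolutionOfSingularities.ResolutionOfSingularities.Theses.HomologicalConductor.PersistenceSurface := by
  intro p hp k K _ _ _ _ O A hk hA hfr hAO hdim ca loc chart nrm tower m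
  show NoZeno.Birth.ca (NoZeno.Birth.tower O A m) ⊆ NoZeno.Birth.ca (NoZeno.Birth.tower O A (m + 1))
  rcases h p hp k K O A hk hA hfr hAO hdim m with hreg | hmax | hstep
  · exact ca_subset_ca_succ_of_isRegularLocalRing_succ O A m hreg
  · exact ca_subset_ca_succ_of_forall_valuation_lt_one_mem_ca O A hk hA hfr hAO m hmax
  · exact hstep

/-! ## Ring-internal form: non-units of the upper stage in its cohomology annihilator

(Appended by leafhand-res-homologicalconduct-10, same generation.)  The door above is fed by computations of
`ca` made INSIDE the ring `↥T_(m+1)` (`Literature.RingTheory.CohomologyAnnihilator.cohomologyAnnihilator`, e.g.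
`…PersistenceCyclicQuotientVeronese`); the bridge is that an element of `O`-value `< 1` is never a unit of a stage
`T ⊆ O`. -/

/-- An element of a stage `T_m ⊆ O` of `O`-value `< 1` is not a unit of `T_m` (its inverse would lie in
`T_m ⊆ O`, forcing value `≥ 1`). [folklore] -/
theorem not_isUnit_of_valuation_lt_one (O : ValuationSubring K) (A : Subalgebra k K)
    (hk : ∀ c : k, algebraMap k K c ∈ O) (hAO : A.toSubring ≤ O.toSubring) (m : ℕ) {y : K}
    (hy : y ∈ tower O A m) (hv : O.valuation y < 1) : ¬ IsUnit (⟨y, hy⟩ : ↥(tower O A m)) := by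
  intro hu
  obtain ⟨u, hu⟩ := hu
  -- the inverse of the unit, read in `K`, is `y⁻¹` and lies in `T_m ⊆ O`
  have hy0 : y ≠ 0 := by
    intro h0
    have h1 : ((u⁻¹ : (↥(tower O A m))ˣ) : ↥(tower O A m)) * (u : ↥(tower O A m)) = 1 := u.inv_mul
    rw [hu] at h1
    have h2 := congrArg (fun z : ↥(tower O A m) => (z : K)) h1
    simp only [Subalgebra.coe_mul, Subalgebra.coe_one, h0, mul_zero] at h2
    exact zero_ne_one h2
  have hinvT : y⁻¹ ∈ tower O A m := by
    have hmem : (((u⁻¹ : (↥(tower O A m))ˣ) : ↥(tower O A m)) : K) ∈ tower O A m := Subtype.coe_prop _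
    have h1 : ((u⁻¹ : (↥(tower O A m))ˣ) : ↥(tower O A m)) * (u : ↥(tower O A m)) = 1 := u.inv_mul
    rw [hu] at h1
    have h2 := congrArg (fun z : ↥(tower O A m) => (z : K)) h1
    simp only [Subalgebra.coe_mul, Subalgebra.coe_one] at h2
    -- `h2 : ↑↑u⁻¹ * y = 1`, so `↑↑u⁻¹ = y⁻¹`
    have h3 : (((u⁻¹ : (↥(tower O A m))ˣ) : ↥(tower O A m)) : K) = y⁻¹ :=
      eq_inv_of_mul_eq_one_left h2
    rw [h3] at hmem
    exact hmem
  have hinvO : y⁻¹ ∈ O := mem_valuationSubring_of_mem_tower O hk hAO m _ hinvT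
  have hle : O.valuation y⁻¹ ≤ 1 := (O.valuation_le_one_iff _).mpr hinvO
  rw [map_inv₀] at hle
  have hvy0 : O.valuation y ≠ 0 := fun h0 => hy0 ((map_eq_zero O.valuation).mp h0)
  have h1le : 1 ≤ O.valuation y := (inv_le_one₀ (zero_lt_iff.mpr hvy0)).mp hle
  exact absurd hv (not_lt.mpr h1le)

/-- **The door, ring-internal form.**  If every NON-UNIT of the ring `↥T_(m+1)` lies in its cohomology annihilator
ideal `ca(↥T_(m+1))` («maximal cohomology annihilator», e.g. a regular stage, an `A₁` point, the vertex of a cone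
over a rational normal curve), then `ca(T_m) ⊆ ca(T_(m+1))`. [OURS · L1 w44b] -/
theorem ca_subset_ca_succ_of_forall_not_isUnit_mem_cohomologyAnnihilator (O : ValuationSubring K)
    (A : Subalgebra k K) (hk : ∀ c : k, algebraMap k K c ∈ O) (hA : A.FG) (hfr : IsFractionRing ↥A K)
    (hAO : A.toSubring ≤ O.toSubring) (m : ℕ)
    (hmax : ∀ y : ↥(tower O A (m + 1)), ¬ IsUnit y →
      y ∈ Literature.RingTheory.CohomologyAnnihilator.cohomologyAnnihilator ↥(tower O A (m + 1))) :
    ca (tower O A m) ⊆ ca (tower O A (m + 1)) := by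
  refine ca_subset_ca_succ_of_forall_valuation_lt_one_mem_ca O A hk hA hfr hAO m fun y hy hv => ?_
  have h := hmax ⟨y, hy⟩ (not_isUnit_of_valuation_lt_one O A hk hAO (m + 1) hy hv)
  exact (tn_coe_mem_ca_iff (tower O A (m + 1)) ⟨y, hy⟩).mpr h

end Summit.ResolutionOfSingularities.ResolutionOfSingularities.Theorems.HomologicalConductor.PersistenceSurfaceMaximalAnnihilatorStep

end
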